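import Summits.Ventures.Crystal3D.Theorems.StickyWulffConstantCoaxialWallLawSeamMotifConsumer
import HarnessLib

/-!
# MOTIF-FREE END POOLS: the honest replacement of `ResidualMotifReduction` in the T5b split (crux `CoaxialWallLaw`, stmt-Ventures-19481;
# line `WallLedgerF`, skeleton 'CoaxialWallLawCertificates' v6 → v7)

HONEST FRAMING. Venture `Summits/Ventures/Crystal3D` (cell `crystal3d-full`); DEFINITIONS + compositions for the crux `CoaxialWallLaw` (stmt-Ventures-19481,
`route-Ventures-StickyWulffConstant`), line 'Certificates' v6 (registered 13:58Z), stub `stub_residualMotifReduction`.  Nothing is claimed; F-C1 not moved.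
WHY THIS FILE (19481-p2 g11, 14:30Z retraction): the registered `stub_residualMotifReduction : ResidualMotifReduction 3` («a residual payer window admits a
deletion on-site, or contains adjacent twin readers with distinct axes, or a seam motif») is FALSE as typed.  Counterexample family: two PARALLEL fcc grains
`A` and `B = A + τ` in the plate frame `L`, meeting across an INCLINED `{111}` facet of `A`, generic offset `τ` adjusted so that one `B`-facet ball `b_B`
touches the `A`-facet payer `z` exactly.  Then `(z, z − d)` is an (A)-end pair of grain `A` and `(b_B, b_B − d′)` one of grain `B` (full readers one layer
inside, predecessor present, targets not moving: facet balls are neither full nor narrow — `b + d ∉ X` — nor twin-reading — mirror positions generically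
empty); every placement fails one of the two pairs (⇒ `¬ MonoModuleAt`), no twin reader exists at all (⇒ `¬ AdjacentTwinReadersAt`, `¬ MotifAt`), no deletion
lands on-site (`b_B` touches `z`, `b_B − d′` touches `b_B`, its dozen touches it, all within `2` of `z`), `¬ JammedOneAt`, `3 < deg z ≤ 11`.  In that family the
END-POOL inequality holds with margin (`e ≤ 2`, `p ≥ 7`: every `{111}`-facet ball keeps deficiency `≥ 1` under incoherent healing by `…HealCap`).
So the motif-free branch must end in POOLS, not in a contradiction:
* `MotifFreeEndPools p₀ k₀` — residual-payer hypotheses ∧ `¬ AdjacentTwinReadersAt` ∧ `¬ MotifAt` ⇒ deletion on-site ∨ `p₀ · endMultA b ≤ pooledDef b` for every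
  ball `b` within `1` of the payer (the «incoherent contacts are sparse» statement; its truth also requires the motif list `MotifAt` to be COMPLETE for coherent
  junctions — open: direct Σ9 boundaries without the twin lamella, one-layer lamella stacks with non-parallel twin planes, foreign grains sharing one unit
  triangle with the exact skeleton);
* `motifFreeEndPools_of_reduction` — the refuted statement implies the new one (so nothing typed against v6 is lost);
* `endPools_of_motifFree` — `MotifFreeEndPools p₀ k₀ → TwinTwinDichotomy → MotifEndPools p₀ k₀ → EndPools p₀ k₀`;
* **`seamResidual_of_motifFree_of_dichotomy_of_endPools`** — `MotifFreeEndPools (√6) 3 → TwinTwinDichotomy → MotifEndPools (√6) 3 →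
  (KissingGap (5/2) → KissingClassification (5/2) → SeamResidual (2·√6) 3)` — the v7 derivation of `stub_seamResidual`.
WHAT THIS IS NOT: `MotifFreeEndPools (√6) 3` is not proved or claimed (crux-sized); `¬ ResidualMotifReduction 3` is not landed (the counterexample needs two
half-crystals in the tree); F-C1 not moved.
-/

noncomputable section

namespace Summit.Ventures.Crystal3D.Theorems

namespace TailResidue

open Summit.Ventures.Crystal3D Finset
open scoped InnerProductSpace

open scoped Classical in
/-- **MOTIF-FREE END POOLS at ratio `p₀` (named input, OPEN; replaces `ResidualMotifReduction`)**: at a residual payer window (`1`-separated, `deg z ≤ 11`,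
off-site for 𝒰_cx, not mono-module for `L`, `k₀ < deg z`, not jammed-one) WITHOUT adjacent twin readers of distinct axes within `2` and WITHOUT a seam motif,
a deletion of inessential balls lands on-site or every ball `b` within `1` of the payer has `p₀ · endMultA b ≤ pooledDef b` (v2, clause (A), joint basal
systems of `L`). -/
def MotifFreeEndPools (p₀ : ℝ) (k₀ : ℕ) : Prop :=
  ∀ L : EuclideanSpace ℝ (Fin 3) ≃ₗᵢ[ℝ] EuclideanSpace ℝ (Fin 3),
  ∀ X : Finset (EuclideanSpace ℝ (Fin 3)), (∀ p ∈ X, ∀ q ∈ X, p ≠ q → 1 ≤ dist p q) →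
  ∀ z ∈ X, (X.filter fun q => dist z q = 1).card ≤ 11 → ¬ OnSiteAt coaxialModuleUniverse X z → ¬ MonoModuleAt L X z →
    k₀ < (X.filter fun q => dist z q = 1).card → ¬ JammedOneAt X z → ¬ AdjacentTwinReadersAt X z → ¬ MotifAt X z →
    HasDeletionOnSite X z ∨
      ∀ b ∈ X, dist z b ≤ 1 →
        p₀ * (endMultA X WordVersion.v2 (basalSystem L) (basalSystem (((ℝ ∙ EuclideanSpace.single (2 : Fin 3) (1 : ℝ)).reflection).trans L)) b : ℝ) ≤
          pooledDef X b

/-- Monotonicity: a larger ratio and a smaller degree threshold are stronger. -/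
theorem motifFreeEndPools_mono {p₀ p₁ : ℝ} {k₀ k₁ : ℕ} (h : MotifFreeEndPools p₁ k₀) (hp : p₀ ≤ p₁) (hk : k₀ ≤ k₁) : MotifFreeEndPools p₀ k₁ := by
  intro L X hX z hz hdeg hoff hM hk' hJ hadj hmot
  rcases h L X hX z hz hdeg hoff hM (lt_of_le_of_lt hk hk') hJ hadj hmot with hdel | hpool
  · exact Or.inl hdel
  · refine Or.inr fun b hb hzb => le_trans ?_ (hpool b hb hzb)
    exact mul_le_mul_of_nonneg_right hp (Nat.cast_nonneg _)

/-- The (refuted, stronger) reduction implies the motif-free end-pool statement: nothing typed against v6 is lost. -/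
theorem motifFreeEndPools_of_reduction {p₀ : ℝ} {k₀ : ℕ} (h : ResidualMotifReduction k₀) : MotifFreeEndPools p₀ k₀ := by
  intro L X hX z hz hdeg hoff hM hk hJ hadj hmot
  rcases h L X hX z hz hdeg hoff hM hk hJ with hdel | h' | h'
  · exact Or.inl hdel
  · exact absurd h' hadj
  · exact absurd h' hmot

/-- **Motif-free pools + dichotomy + motif pools ⇒ end pools.** -/
theorem endPools_of_motifFree {p₀ : ℝ} {k₀ : ℕ} (hfree : MotifFreeEndPools p₀ k₀) (hdich : TwinTwinDichotomy) (hmot : MotifEndPools p₀ k₀) :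
    EndPools p₀ k₀ := by
  intro L X hX z hz hdeg hoff hM hk hJ
  by_cases hadj : AdjacentTwinReadersAt X z
  · exact hmot L X hX z hz hdeg hoff hM hk hJ (motifAt_of_adjacentTwinReaders hdich hX hadj)
  by_cases hm : MotifAt X z
  · exact hmot L X hX z hz hdeg hoff hM hk hJ hm
  exact hfree L X hX z hz hdeg hoff hM hk hJ hadj hm

/-- **THE v7 DERIVATION of `stub_seamResidual`**: motif-free end pools, the twin–twin dichotomy and the motif end pools at ratio `√6` settle
`SeamResidual (2·√6) 3`. -/
theorem seamResidual_of_motifFree_of_dichotomy_of_endPools (hfree : MotifFreeEndPools (Real.sqrt 6) 3) (hdich : TwinTwinDichotomy)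
    (hmot : MotifEndPools (Real.sqrt 6) 3) :
    KissingGap (5 / 2) → KissingClassification (5 / 2) → SeamResidual (2 * Real.sqrt 6) 3 :=
  fun _ _ => seamResidual_of_endPools (endPools_of_motifFree hfree hdich hmot) le_rfl

end TailResidue

end Summit.Ventures.Crystal3D.Theorems

end
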